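import Summits.CriticalPhenomena.Ising3DConformalLimit.Theses.HyperoctahedralRP
import Summits.CriticalPhenomena.Ising3DConformalLimit.Theses.IsingEuclidUpgrade
import Summits.CriticalPhenomena.Ising3DConformalLimit.Theses.ArmHyperscaling
import Summits.CriticalPhenomena.Ising3DConformalLimit.Theses.LeeYangGap
import Summits.CriticalPhenomena.Ising3DConformalLimit.Theorems.LeeYangGapGaussianLimitKillsBlockCoupling
import Summits.CriticalPhenomena.Ising3DConformalLimit.Theorems.PerfectScreeningCoulombImpliesNontrivialBlockFieldDomination
import Summits.CriticalPhenomena.Ising3DConformalLimit.Theorems.PerfectScreeningCoulombImpliesNontrivialOfLeeYangGap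
import Literature.Probability.LatticeModels.PointwiseScalingLimitScaleCovariant
import Literature.Probability.LatticeModels.HighDimPointwiseTriviality
import Literature.Probability.LatticeModels.CriticalTwoPointLower
import Literature.Barriers.CriticalPhenomena.IsingTrivialityFromDimensionFourProofs

/-!
# Strategist glue & payer edges for crux stmt-CriticalPhenomena-0636 (`IsingEuclidUpgradeR4NonGaussian`)

Crux-strategist seat planner-cstrat-stmt-CriticalPhenomena-0636-s1-0 (gen 1, re-arm), 2026-08-17.
SORRY-FREE companion of the registered line `Lines/isotherm_saturation_lee_yang.lean` (strategist p1):
nothing here is new mathematics; the file exists so that a PROVER can land it verbatim under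
`Summits/CriticalPhenomena/Ising3DConformalLimit/Theorems/IsingEuclidUpgradeR4NonGaussianIsothermSplit.lean`
with `--supports stmt-CriticalPhenomena-0636` (Theorems is prover-only), after which

* the prepared ROUTE-LEVEL SPLIT of the crux (children `MatchedUpperIsotherm` (crux) /
  `LeeYangDeficit` (support), statements = `MatchedUpperIsotherm` / `LeeYangDeficit` below, evidence
  `children.json` on the item) can be installed by the tenure planner with
  `ledger route edit <route> --split IsingEuclidUpgradeR4NonGaussian --into children.json --glue-by
   <landed name of isingEuclidUpgradeR4NonGaussian_of_subs>`;
* the ledger shows the PAYER EDGE `LeeYangGap.NearCriticalLeeYangGap (stmt-4945) ⟹ 0636` for EVERY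
  non-degenerate limit (not only the Möbius one of route LeeYangGap's assembly):
  `isingEuclidUpgradeR4NonGaussian_of_nearCriticalLeeYangGap`.

Contents.
§1 `MatchedUpperIsotherm`, `LeeYangDeficit` — the two children as `Prop`s (verbatim the registered stub
   statements S1, S2 of the line).
§2 (copied verbatim from the registered skeleton, where they are already free of `sorry`)
   `binder_lower_of_saturation`, `eventually_binder_ge`, `exists_normalised`,
   `IsingEuclidUpgradeR4NonGaussian_of` (S2 → S1 → IsingEuclidUpgrade decl), `…_of_hyperoctahedralRP`,
   `…_of_oneArm` (S2 → (15591 → S1) → 15591 → crux).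
§3 `isingEuclidUpgradeR4NonGaussian_of_subs : LeeYangDeficit → MatchedUpperIsotherm → crux` (the
   `--glue-by` form over the §1 names) and the HyperoctahedralRP copy.
§4 payer edge from the near-critical Lee–Yang gap (item 4945): landed
   `sketchPub_binderNonvanishing_of_nearCriticalLeeYangGap` (GAP ⟹ g_L ↛ 0) + landed
   `gaussianLimitKillsBlockCoupling_proof` (4950: Gaussian non-degenerate scale-covariant limit ⟹ g_L → 0)
   + `exists_normalised` (scale covariance is automatic after normalising `S` off `NonCoincident`).
-/

noncomputable section

namespace Summit.CriticalPhenomena.Ising3DConformalLimit.Cruxes.IsingEuclidUpgradeR4NonGaussian.StrategistS1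

open Literature.Probability.LatticeModels Filter Set Finset
open scoped Topology BigOperators


/-! ## §1 The two children of the prepared split -/

/-- **Child 1 (crux of the split) — MATCHED UPPER CRITICAL ISOTHERM** (= registered stub S1
`stub_matchedUpperIsotherm` of line `isotherm-saturation-lee-yang`, verbatim): for every non-degenerate
scale-covariant pointwise limit there is `C > 0` with `(2L+1)³ · m(β_c, C/√Σ_L) ≤ ½ β_c C √Σ_L` for all
large `L` (`Σ_L = ⟨M_L²⟩_{β_c}`). Hyperscaling equality for `δ` as an upper bound with amplitude at the
CLT field scale; false for `d ≥ 5`; open on `ℤ³`. -/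
def MatchedUpperIsotherm : Prop :=
    ∀ (ρ : ℝ → ℝ) (Δ : ℝ) (S : CorrFamily 3), (∀ δ ∈ Set.Ioc (0:ℝ) 1, 0 < ρ δ) →
      HasPointwiseScalingLimit (criticalCorr 3) ρ S → IsNondegenerateTwoPoint S →
      IsScaleCovariant Δ S →
      ∃ C : ℝ, 0 < C ∧ ∀ᶠ L : ℕ in atTop,
        (2 * (L : ℝ) + 1) ^ 3 * magnetizationInField 3 (criticalBeta 3)
            (C / Real.sqrt (plusExpect 3 (criticalBeta 3) 0 (fun σ => (∑ x ∈ box 3 L, spinAt x σ) ^ 2))) ≤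
          criticalBeta 3 * C / 2 *
            Real.sqrt (plusExpect 3 (criticalBeta 3) 0 (fun σ => (∑ x ∈ box 3 L, spinAt x σ) ^ 2))

/-- **Child 2 (support of the split) — LEE–YANG SATURATION DEFICIT** (= registered stub S2
`stub_leeYangDeficit`, verbatim): for the critical block spin and every tilt `t ≥ 0`,
`⟨e^{tM_L}⟩ > 0` and `(Σ_L t − t³(3Σ_L² − ⟨M_L⁴⟩))·⟨e^{tM_L}⟩ ≤ ⟨M_L e^{tM_L}⟩`. Provable now (M) from the
landed `stub_blockLaw` + `stub_leeYangPackage`; the scalar inequalities it needs are certified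
numerically in STRATEGY-CENSUS.md §B.1 (`t − tanh t ≤ t³/3`, `t − sinh t cosh t/(1 + b sinh² t) ≤ b t³`
for `b ≥ 1`, `t ≥ 0`, whence deficit `≤ (m/3 + 2Σbᵢ²) t³ ≤ (2m + 4Σbᵢ²) t³ ≤ (3Σ² − Q) t³`). -/
def LeeYangDeficit : Prop :=
    ∀ (L : ℕ) (t : ℝ), 0 ≤ t →
      0 < plusExpect 3 (criticalBeta 3) 0 (fun σ => Real.exp (t * ∑ x ∈ box 3 L, spinAt x σ)) ∧
      (plusExpect 3 (criticalBeta 3) 0 (fun σ => (∑ x ∈ box 3 L, spinAt x σ) ^ 2) * t -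
          t ^ 3 * (3 * (plusExpect 3 (criticalBeta 3) 0 (fun σ => (∑ x ∈ box 3 L, spinAt x σ) ^ 2)) ^ 2 -
            plusExpect 3 (criticalBeta 3) 0 (fun σ => (∑ x ∈ box 3 L, spinAt x σ) ^ 4))) *
        plusExpect 3 (criticalBeta 3) 0 (fun σ => Real.exp (t * ∑ x ∈ box 3 L, spinAt x σ)) ≤
      plusExpect 3 (criticalBeta 3) 0
        (fun σ => (∑ x ∈ box 3 L, spinAt x σ) * Real.exp (t * ∑ x ∈ box 3 L, spinAt x σ))

/-! ## §2 Composition (verbatim from the registered skeleton) -/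

/-- The real arithmetic at one block: deficit + domination + matched isotherm give the Binder floor.
With `Sg = Σ_L > 0`, `t = β C/√Sg`, `K = 3Σ_L² - ⟨M_L⁴⟩`, `Z = ⟨e^{tM}⟩ > 0`:
`(Sg t - t³K) Z ≤ T ≤ Nm Z` and `Nm ≤ β C/2 · √Sg` force `1/(2β²C²) ≤ K/Sg²`. -/
theorem binder_lower_of_saturation {β C Sg K Z T Nm : ℝ} (hβ : 0 < β) (hC : 0 < C) (hSg : 0 < Sg)
    (hZ : 0 < Z)
    (hdef : (Sg * (β * (C / Real.sqrt Sg)) - (β * (C / Real.sqrt Sg)) ^ 3 * K) * Z ≤ T)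
    (hdom : T ≤ Nm * Z) (hiso : Nm ≤ β * C / 2 * Real.sqrt Sg) :
    1 / (2 * β ^ 2 * C ^ 2) ≤ K / Sg ^ 2 := by
  set s : ℝ := Real.sqrt Sg with hs
  have hs0 : 0 < s := Real.sqrt_pos.2 hSg
  have hs2 : s ^ 2 = Sg := Real.sq_sqrt hSg.le
  set t : ℝ := β * (C / s) with ht
  have ht0 : 0 < t := by positivity
  -- cancel `Z`
  have h1 : Sg * t - t ^ 3 * K ≤ Nm := le_of_mul_le_mul_right (hdef.trans hdom) hZ
  -- `Nm ≤ t Sg / 2`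
  have h2 : β * C / 2 * s = t * Sg / 2 := by
    rw [ht, ← hs2]; field_simp
  have h3 : Sg * t - t ^ 3 * K ≤ t * Sg / 2 := h1.trans (hiso.trans_eq h2)
  -- hence `Sg / 2 ≤ t² K`
  have h4 : t * (Sg / 2) ≤ t * (t ^ 2 * K) := by nlinarith
  have h5 : Sg / 2 ≤ t ^ 2 * K := le_of_mul_le_mul_left h4 ht0
  -- `t² Sg = β² C²`
  have h6 : t ^ 2 * Sg = β ^ 2 * C ^ 2 := by
    rw [ht, ← hs2]; field_simp
  have hSg2 : 0 < Sg ^ 2 := by positivity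
  rw [div_le_div_iff₀ (by positivity) hSg2]
  calc 1 * Sg ^ 2 = 2 * (Sg / 2) * Sg := by ring
    _ ≤ 2 * (t ^ 2 * K) * Sg := by gcongr
    _ = K * (2 * (t ^ 2 * Sg)) := by ring
    _ = K * (2 * β ^ 2 * C ^ 2) := by rw [h6]; ring

/-- **Matched saturation forces a Binder floor** (S2 + landed GKS block-field domination + S1, for a given
limit): eventually `1/(2β_c²C²) ≤ g_L`. -/
theorem eventually_binder_ge
    (hdef : ∀ (L : ℕ) (t : ℝ), 0 ≤ t →
      0 < plusExpect 3 (criticalBeta 3) 0 (fun σ => Real.exp (t * ∑ x ∈ box 3 L, spinAt x σ)) ∧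
      (plusExpect 3 (criticalBeta 3) 0 (fun σ => (∑ x ∈ box 3 L, spinAt x σ) ^ 2) * t -
          t ^ 3 * (3 * (plusExpect 3 (criticalBeta 3) 0 (fun σ => (∑ x ∈ box 3 L, spinAt x σ) ^ 2)) ^ 2 -
            plusExpect 3 (criticalBeta 3) 0 (fun σ => (∑ x ∈ box 3 L, spinAt x σ) ^ 4))) *
        plusExpect 3 (criticalBeta 3) 0 (fun σ => Real.exp (t * ∑ x ∈ box 3 L, spinAt x σ)) ≤
      plusExpect 3 (criticalBeta 3) 0
        (fun σ => (∑ x ∈ box 3 L, spinAt x σ) * Real.exp (t * ∑ x ∈ box 3 L, spinAt x σ)))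
    (hiso : ∀ (ρ : ℝ → ℝ) (Δ : ℝ) (S : CorrFamily 3), (∀ δ ∈ Set.Ioc (0:ℝ) 1, 0 < ρ δ) →
      HasPointwiseScalingLimit (criticalCorr 3) ρ S → IsNondegenerateTwoPoint S →
      IsScaleCovariant Δ S →
      ∃ C : ℝ, 0 < C ∧ ∀ᶠ L : ℕ in atTop,
        (2 * (L : ℝ) + 1) ^ 3 * magnetizationInField 3 (criticalBeta 3)
            (C / Real.sqrt (plusExpect 3 (criticalBeta 3) 0 (fun σ => (∑ x ∈ box 3 L, spinAt x σ) ^ 2))) ≤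
          criticalBeta 3 * C / 2 *
            Real.sqrt (plusExpect 3 (criticalBeta 3) 0 (fun σ => (∑ x ∈ box 3 L, spinAt x σ) ^ 2)))
    {ρ : ℝ → ℝ} {Δ : ℝ} {S : CorrFamily 3}
    (hρ : ∀ δ ∈ Set.Ioc (0:ℝ) 1, 0 < ρ δ) (hlim : HasPointwiseScalingLimit (criticalCorr 3) ρ S)
    (hnd : IsNondegenerateTwoPoint S) (hsc : IsScaleCovariant Δ S) :
    ∃ c : ℝ, 0 < c ∧ ∀ᶠ L : ℕ in atTop,
      c ≤ (3 * (plusExpect 3 (criticalBeta 3) 0 (fun σ => (∑ x ∈ box 3 L, spinAt x σ) ^ 2)) ^ 2 -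
              plusExpect 3 (criticalBeta 3) 0 (fun σ => (∑ x ∈ box 3 L, spinAt x σ) ^ 4)) /
            (plusExpect 3 (criticalBeta 3) 0 (fun σ => (∑ x ∈ box 3 L, spinAt x σ) ^ 2)) ^ 2 := by
  have hβ : 0 < criticalBeta 3 := criticalBeta_pos_holds (d := 3) (by norm_num)
  obtain ⟨C, hC, hev⟩ := hiso ρ Δ S hρ hlim hnd hsc
  refine ⟨1 / (2 * criticalBeta 3 ^ 2 * C ^ 2), by positivity, ?_⟩
  filter_upwards [hev] with L hL
  set Sg : ℝ := plusExpect 3 (criticalBeta 3) 0 (fun σ => (∑ x ∈ box 3 L, spinAt x σ) ^ 2) with hSgdef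
  have hSg : 0 < Sg := by
    simpa [hSgdef, Literature.Barriers.CriticalPhenomena.blockVariance,
      Literature.Barriers.CriticalPhenomena.blockSpin] using
      Literature.Barriers.CriticalPhenomena.blockVariance_pos (d := 3) (criticalBeta_nonneg 3) L
  set h : ℝ := C / Real.sqrt Sg with hh
  have hh0 : 0 ≤ h := by positivity
  -- domination at field `h` (tilt `β_c h`)
  have hdom := Summit.CriticalPhenomena.Ising3DConformalLimit.PerfectScreeningCoulombImpliesNontrivial.stub_blockFieldDomination
    L h hh0
  -- deficit at tilt `t = β_c h`
  obtain ⟨hZ, hdefL⟩ := hdef L (criticalBeta 3 * h) (by positivity)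
  have key := binder_lower_of_saturation (β := criticalBeta 3) (C := C) (Sg := Sg)
    (K := 3 * Sg ^ 2 - plusExpect 3 (criticalBeta 3) 0 (fun σ => (∑ x ∈ box 3 L, spinAt x σ) ^ 4))
    hβ hC hSg hZ (by simpa [hh, mul_assoc] using hdefL) hdom (by simpa [hh] using hL)
  simpa [hSgdef] using key

/-- Normalisation glue: every non-degenerate pointwise limit has a normalisation `S'` (zero off
`NonCoincident`) that is again a non-degenerate pointwise limit with the same `ρ`, is scale covariant with
the automatic dimension, and whose `U₄`-non-triviality implies that of `S`. -/
theorem exists_normalised {ρ : ℝ → ℝ} {S : CorrFamily 3}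
    (hρ : ∀ δ ∈ Set.Ioc (0:ℝ) 1, 0 < ρ δ) (hlim : HasPointwiseScalingLimit (criticalCorr 3) ρ S)
    (hnd : IsNondegenerateTwoPoint S) :
    ∃ (Δ : ℝ) (S' : CorrFamily 3), HasPointwiseScalingLimit (criticalCorr 3) ρ S' ∧
      IsNondegenerateTwoPoint S' ∧ IsScaleCovariant Δ S' ∧ (HasNontrivialU4 S' → HasNontrivialU4 S) := by
  classical
  set S' : CorrFamily 3 := fun n z => if Function.Injective z then S n z else 0 with hS'
  have S'_inj : ∀ {n : ℕ} {z : Fin n → EuclideanSpace ℝ (Fin 3)}, Function.Injective z →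
      S' n z = S n z := fun hz => by simp only [hS', if_pos hz]
  have S'_ninj : ∀ {n : ℕ} {z : Fin n → EuclideanSpace ℝ (Fin 3)}, ¬ Function.Injective z →
      S' n z = 0 := fun hz => by simp only [hS', if_neg hz]
  have hlim' : HasPointwiseScalingLimit (criticalCorr 3) ρ S' :=
    fun n => (hlim n).congr_right fun z hz => (S'_inj hz).symm
  have hnd' : IsNondegenerateTwoPoint S' := fun z hz => by rw [S'_inj hz]; exact hnd z hz
  obtain ⟨Δ, -, hcov⟩ := hlim'.exists_rpow_scale_mem_Icc hρ hnd'
  have hsc' : IsScaleCovariant Δ S' := by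
    intro n c hc z
    by_cases hz : Function.Injective z
    · exact hcov n c hc z hz
    · have hz' : ¬ Function.Injective (fun i => c • z i) := fun h =>
        hz ((smul_right_injective (EuclideanSpace ℝ (Fin 3)) hc.ne').of_comp_iff z |>.1 h)
      rw [S'_ninj hz', S'_ninj hz, mul_zero]
  refine ⟨Δ, S', hlim', hnd', hsc', ?_⟩
  rintro ⟨x, hx, hne⟩
  refine ⟨x, hx, ?_⟩
  have hinj : Function.Injective x := hx
  have hpair : ∀ i j : Fin 4, i ≠ j → S' 2 ![x i, x j] = S 2 ![x i, x j] := by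
    intro i j hij
    exact S'_inj (pair_mem_nonCoincident (d := 3) fun h => hij (hinj h))
  have h4 : S' 4 x = S 4 x := S'_inj hinj
  simp only [limitConnectedFour] at hne ⊢
  rwa [h4, hpair 0 1 (by decide), hpair 2 3 (by decide), hpair 0 2 (by decide), hpair 1 3 (by decide),
    hpair 0 3 (by decide), hpair 1 2 (by decide)] at hne

/-- **COMPOSITION.** S2 (Lee–Yang deficit) and S1 (matched upper critical isotherm) give the crux
`IsingEuclidUpgradeR4NonGaussian` — the IsingEuclidUpgrade decl of item stmt-CriticalPhenomena-0636, by name. -/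
theorem IsingEuclidUpgradeR4NonGaussian_of :
    (∀ (L : ℕ) (t : ℝ), 0 ≤ t →
      0 < plusExpect 3 (criticalBeta 3) 0 (fun σ => Real.exp (t * ∑ x ∈ box 3 L, spinAt x σ)) ∧
      (plusExpect 3 (criticalBeta 3) 0 (fun σ => (∑ x ∈ box 3 L, spinAt x σ) ^ 2) * t -
          t ^ 3 * (3 * (plusExpect 3 (criticalBeta 3) 0 (fun σ => (∑ x ∈ box 3 L, spinAt x σ) ^ 2)) ^ 2 -
            plusExpect 3 (criticalBeta 3) 0 (fun σ => (∑ x ∈ box 3 L, spinAt x σ) ^ 4))) *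
        plusExpect 3 (criticalBeta 3) 0 (fun σ => Real.exp (t * ∑ x ∈ box 3 L, spinAt x σ)) ≤
      plusExpect 3 (criticalBeta 3) 0
        (fun σ => (∑ x ∈ box 3 L, spinAt x σ) * Real.exp (t * ∑ x ∈ box 3 L, spinAt x σ))) →
    (∀ (ρ : ℝ → ℝ) (Δ : ℝ) (S : CorrFamily 3), (∀ δ ∈ Set.Ioc (0:ℝ) 1, 0 < ρ δ) →
      HasPointwiseScalingLimit (criticalCorr 3) ρ S → IsNondegenerateTwoPoint S →
      IsScaleCovariant Δ S →
      ∃ C : ℝ, 0 < C ∧ ∀ᶠ L : ℕ in atTop,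
        (2 * (L : ℝ) + 1) ^ 3 * magnetizationInField 3 (criticalBeta 3)
            (C / Real.sqrt (plusExpect 3 (criticalBeta 3) 0 (fun σ => (∑ x ∈ box 3 L, spinAt x σ) ^ 2))) ≤
          criticalBeta 3 * C / 2 *
            Real.sqrt (plusExpect 3 (criticalBeta 3) 0 (fun σ => (∑ x ∈ box 3 L, spinAt x σ) ^ 2))) →
    Summit.CriticalPhenomena.Ising3DConformalLimit.Theses.IsingEuclidUpgrade.IsingEuclidUpgradeR4NonGaussian := by
  intro hdef hiso ρ S hρ hlim hnd
  obtain ⟨Δ, S', hlim', hnd', hsc', hback⟩ := exists_normalised hρ hlim hnd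
  refine hback ?_
  by_contra hU4
  have htend := Summit.CriticalPhenomena.Ising3DConformalLimit.LeeYangGapGaussianLimitKillsBlockCoupling.gaussianLimitKillsBlockCoupling_proof
    ρ Δ S' hρ hlim' hnd' hsc' hU4
  obtain ⟨c, hc, hlow⟩ := eventually_binder_ge hdef hiso hρ hlim' hnd' hsc'
  have hup := htend.eventually (gt_mem_nhds hc)
  obtain ⟨L, h1, h2⟩ := (hlow.and hup).exists
  exact absurd h1 (not_le.2 h2)

/-- **COMPOSITION** for the HyperoctahedralRP copy of the shared decl (primary route of the crux chain;
definitionally the same statement). -/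
theorem IsingEuclidUpgradeR4NonGaussian_of_hyperoctahedralRP :
    (∀ (L : ℕ) (t : ℝ), 0 ≤ t →
      0 < plusExpect 3 (criticalBeta 3) 0 (fun σ => Real.exp (t * ∑ x ∈ box 3 L, spinAt x σ)) ∧
      (plusExpect 3 (criticalBeta 3) 0 (fun σ => (∑ x ∈ box 3 L, spinAt x σ) ^ 2) * t -
          t ^ 3 * (3 * (plusExpect 3 (criticalBeta 3) 0 (fun σ => (∑ x ∈ box 3 L, spinAt x σ) ^ 2)) ^ 2 -
            plusExpect 3 (criticalBeta 3) 0 (fun σ => (∑ x ∈ box 3 L, spinAt x σ) ^ 4))) *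
        plusExpect 3 (criticalBeta 3) 0 (fun σ => Real.exp (t * ∑ x ∈ box 3 L, spinAt x σ)) ≤
      plusExpect 3 (criticalBeta 3) 0
        (fun σ => (∑ x ∈ box 3 L, spinAt x σ) * Real.exp (t * ∑ x ∈ box 3 L, spinAt x σ))) →
    (∀ (ρ : ℝ → ℝ) (Δ : ℝ) (S : CorrFamily 3), (∀ δ ∈ Set.Ioc (0:ℝ) 1, 0 < ρ δ) →
      HasPointwiseScalingLimit (criticalCorr 3) ρ S → IsNondegenerateTwoPoint S →
      IsScaleCovariant Δ S →
      ∃ C : ℝ, 0 < C ∧ ∀ᶠ L : ℕ in atTop,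
        (2 * (L : ℝ) + 1) ^ 3 * magnetizationInField 3 (criticalBeta 3)
            (C / Real.sqrt (plusExpect 3 (criticalBeta 3) 0 (fun σ => (∑ x ∈ box 3 L, spinAt x σ) ^ 2))) ≤
          criticalBeta 3 * C / 2 *
            Real.sqrt (plusExpect 3 (criticalBeta 3) 0 (fun σ => (∑ x ∈ box 3 L, spinAt x σ) ^ 2))) →
    Summit.CriticalPhenomena.Ising3DConformalLimit.Theses.HyperoctahedralRP.IsingEuclidUpgradeR4NonGaussian :=
  fun hdef hiso => IsingEuclidUpgradeR4NonGaussian_of hdef hiso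

/-- **COMPOSITION (second entrance).** S2, S4 and the shared crux S3 (`OneArmHyperscaling`,
stmt-CriticalPhenomena-15591) give the crux. -/
theorem IsingEuclidUpgradeR4NonGaussian_of_oneArm :
    (∀ (L : ℕ) (t : ℝ), 0 ≤ t →
      0 < plusExpect 3 (criticalBeta 3) 0 (fun σ => Real.exp (t * ∑ x ∈ box 3 L, spinAt x σ)) ∧
      (plusExpect 3 (criticalBeta 3) 0 (fun σ => (∑ x ∈ box 3 L, spinAt x σ) ^ 2) * t -
          t ^ 3 * (3 * (plusExpect 3 (criticalBeta 3) 0 (fun σ => (∑ x ∈ box 3 L, spinAt x σ) ^ 2)) ^ 2 -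
            plusExpect 3 (criticalBeta 3) 0 (fun σ => (∑ x ∈ box 3 L, spinAt x σ) ^ 4))) *
        plusExpect 3 (criticalBeta 3) 0 (fun σ => Real.exp (t * ∑ x ∈ box 3 L, spinAt x σ)) ≤
      plusExpect 3 (criticalBeta 3) 0
        (fun σ => (∑ x ∈ box 3 L, spinAt x σ) * Real.exp (t * ∑ x ∈ box 3 L, spinAt x σ))) →
    (Summit.CriticalPhenomena.Ising3DConformalLimit.Theses.ArmHyperscaling.OneArmHyperscaling →
    ∀ (ρ : ℝ → ℝ) (Δ : ℝ) (S : CorrFamily 3), (∀ δ ∈ Set.Ioc (0:ℝ) 1, 0 < ρ δ) →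
      HasPointwiseScalingLimit (criticalCorr 3) ρ S → IsNondegenerateTwoPoint S →
      IsScaleCovariant Δ S →
      ∃ C : ℝ, 0 < C ∧ ∀ᶠ L : ℕ in atTop,
        (2 * (L : ℝ) + 1) ^ 3 * magnetizationInField 3 (criticalBeta 3)
            (C / Real.sqrt (plusExpect 3 (criticalBeta 3) 0 (fun σ => (∑ x ∈ box 3 L, spinAt x σ) ^ 2))) ≤
          criticalBeta 3 * C / 2 *
            Real.sqrt (plusExpect 3 (criticalBeta 3) 0 (fun σ => (∑ x ∈ box 3 L, spinAt x σ) ^ 2))) →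
    Summit.CriticalPhenomena.Ising3DConformalLimit.Theses.ArmHyperscaling.OneArmHyperscaling →
    Summit.CriticalPhenomena.Ising3DConformalLimit.Theses.IsingEuclidUpgrade.IsingEuclidUpgradeR4NonGaussian :=
  fun hdef hS4 hOA => IsingEuclidUpgradeR4NonGaussian_of hdef (hS4 hOA)


/-! ## §3 The `--glue-by` form over the named children -/

/-- **Glue of the prepared split**: `LeeYangDeficit → MatchedUpperIsotherm → IsingEuclidUpgradeR4NonGaussian`
(IsingEuclidUpgrade decl of the shared item stmt-CriticalPhenomena-0636). -/
theorem isingEuclidUpgradeR4NonGaussian_of_subs :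
    LeeYangDeficit → MatchedUpperIsotherm →
      Summit.CriticalPhenomena.Ising3DConformalLimit.Theses.IsingEuclidUpgrade.IsingEuclidUpgradeR4NonGaussian :=
  fun hdef hiso => IsingEuclidUpgradeR4NonGaussian_of hdef hiso

/-- The same glue concluding the HyperoctahedralRP copy of the shared decl. -/
theorem isingEuclidUpgradeR4NonGaussian_of_subs_hyperoctahedralRP :
    LeeYangDeficit → MatchedUpperIsotherm →
      Summit.CriticalPhenomena.Ising3DConformalLimit.Theses.HyperoctahedralRP.IsingEuclidUpgradeR4NonGaussian :=
  fun hdef hiso => IsingEuclidUpgradeR4NonGaussian_of hdef hiso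

/-! ## §4 Payer edge: the near-critical Lee–Yang gap (item stmt-CriticalPhenomena-4945) pays the crux -/

/-- **PAYER EDGE `NearCriticalLeeYangGap ⟹ IsingEuclidUpgradeR4NonGaussian`** (for EVERY non-degenerate
pointwise limit). If for infinitely many `L` some `β ≤ β_c(3)` and some zero `θ > 0` of `⟨cos(θM_L)⟩_β`
have `θ²Σ_L ≤ C` (item 4945 of route LeeYangGap), then every non-degenerate pointwise scaling limit of
`criticalCorr 3` has `U₄ ≢ 0`: normalise `S` off `NonCoincident` (`exists_normalised`: scale covariance
is automatic), a Gaussian such limit forces `g_L → 0` (landed item 4950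
`gaussianLimitKillsBlockCoupling_proof`), which the gap forbids (landed
`sketchPub_binderNonvanishing_of_nearCriticalLeeYangGap`: CJN antitonicity 4947 + transfer 4948 +
Newman's first-zero bound). Any proof of 4945 closes 0636 (hence clause (iii) on all 32 routes). -/
theorem isingEuclidUpgradeR4NonGaussian_of_nearCriticalLeeYangGap
    (hGAP : Summit.CriticalPhenomena.Ising3DConformalLimit.Theses.LeeYangGap.NearCriticalLeeYangGap) :
    Summit.CriticalPhenomena.Ising3DConformalLimit.Theses.IsingEuclidUpgrade.IsingEuclidUpgradeR4NonGaussian := by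
  intro ρ S hρ hlim hnd
  obtain ⟨Δ, S', hlim', hnd', hsc', hback⟩ := exists_normalised hρ hlim hnd
  refine hback ?_
  by_contra hU4
  exact Summit.CriticalPhenomena.Ising3DConformalLimit.PerfectScreeningCoulombImpliesNontrivial.sketchPub_binderNonvanishing_of_nearCriticalLeeYangGap
    hGAP
    (Summit.CriticalPhenomena.Ising3DConformalLimit.LeeYangGapGaussianLimitKillsBlockCoupling.gaussianLimitKillsBlockCoupling_proof
      ρ Δ S' hρ hlim' hnd' hsc' hU4)

/-- The payer edge concluding the HyperoctahedralRP copy (primary route of the crux chain). -/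
theorem isingEuclidUpgradeR4NonGaussian_of_nearCriticalLeeYangGap_hyperoctahedralRP
    (hGAP : Summit.CriticalPhenomena.Ising3DConformalLimit.Theses.LeeYangGap.NearCriticalLeeYangGap) :
    Summit.CriticalPhenomena.Ising3DConformalLimit.Theses.HyperoctahedralRP.IsingEuclidUpgradeR4NonGaussian :=
  isingEuclidUpgradeR4NonGaussian_of_nearCriticalLeeYangGap hGAP

end Summit.CriticalPhenomena.Ising3DConformalLimit.Cruxes.IsingEuclidUpgradeR4NonGaussian.StrategistS1

end
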